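import Literature.Topology.FourManifolds.LickorishWallaceHandlebodies
import Literature.Topology.FourManifolds.HandlebodySymmetricModels
import Literature.Topology.FourManifolds.SphereGenusSplitting
import HarnessLib

/-!
# Lickorish–Wallace, step F2b₁: `S³` has a genus-`g` Heegaard splitting in every universe

Topic `Literature/Topology/FourManifolds`; fact seat
`provefact-Literature.Topology.FourManifolds.IsHandlebody.exists_diffeomorph_isBoundaryGluing_sphere`
(step **F2b₁** of the Lickorish–Wallace DAG of `LickorishWallace.lean`,
`LickorishWallaceSphereGluing.lean`, `LickorishWallaceHandlebodies.lean`): *`S³` is the union of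
any two genus-`g` handlebodies along some diffeomorphism of their boundaries* (Lickorish, Ann. of
Math. 76 (1962), p. 538: "There is a piecewise linear homeomorphism `i` such that `i : X₁ → X₂`
and `S³ = T₁ ∪_i T₂`").

`LickorishWallaceHandlebodies.lean` proves F2b₁ from two named facts,
**UNIQ** `Literature.Topology.FourManifolds.IsHandlebody.nonempty_diffeomorph` (any two genus-`g`
handlebodies are diffeomorphic; Kosinski (1993), VI (11.4)(c); Schultens (2014), §6.1 Exercise 2)
and **SPLIT** `Literature.Topology.FourManifolds.exists_isHeegaardSplitting_genus_sphere` (`S³`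
has a genus-`g` Heegaard splitting for every `g`; Juhász (2023), §3.5, p. 97), both quantified
over an arbitrary universe `u` (forced by `Literature.Topology.FourManifolds.BoundaryData` and
`Literature.Topology.FourManifolds.IsBoundaryGluing`, whose pieces share one universe).
`SphereGenusSplitting.lean` proves SPLIT **in universe `0`**
(`Literature.Topology.FourManifolds.exists_isHeegaardSplitting_sphere_genus_holds'`: the two
halves `{f ≤ c}`, `{c ≤ f}` of a separated Morse pair on the round `𝕊 3`, obtained from a Morse
height function by `g` stabilisations). This file closes the gap:

* `Literature.Topology.FourManifolds.IsBoundaryGluing.ulift` — if `P = M ∪_φ N` then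
  `P = ULift M ∪_{up ∘ φ ∘ down} ULift N` for the lifted boundary data
  (`Literature.Topology.FourManifolds.BoundaryData.ulift` of `HandlebodySymmetricModels.lean`;
  precompose the piece embeddings with `down`, a diffeomorphism); with
  `Literature.Topology.FourManifolds.ManifoldULift.isHandlebody` (ibid.), `IsHeegaardSplitting.ulift`.
* `Literature.Topology.FourManifolds.exists_isHeegaardSplitting_genus_sphere_holds` — **SPLIT
  discharged in every universe**: lift the universe-`0` splitting of `𝕊 3`.
* `Literature.Topology.FourManifolds.IsHandlebody.exists_diffeomorph_isBoundaryGluing_sphere_of_nonempty_diffeomorph'`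
  — hence **F2b₁ follows from UNIQ alone**; and, SYMM being discharged as well
  (`Literature.Topology.FourManifolds.exists_isHandlebody_isOrientationReversing_holds`,
  `HandlebodySymmetricModels.lean`) and F2a outright
  (`Literature.Topology.FourManifolds.IsHandlebody.connectedSpace_boundary_holds`,
  `LickorishWallaceProofs.lean`), **F2b follows from UNIQ alone**
  (`Literature.Topology.FourManifolds.IsHandlebody.exists_isBoundaryGluing_sphere_of_nonempty_diffeomorph''`)
  and the Lickorish–Wallace theorem from F1, UNIQ, F3, F4
  (`Literature.Topology.FourManifolds.exists_isIntegralSurgeryLink_of_lickorish''''`).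

What remains for `IsHandlebody.exists_diffeomorph_isBoundaryGluing_sphere_holds` is exactly UNIQ,
the diffeomorphism classification of genus-`g` handlebodies (Milnor, *Morse theory* (1963),
Thms 3.1–3.2; Kosinski (1993), VI (6.6), (11.4)(c)), reduced further in
`HandlebodyClassification.lean`.

## References

* W. B. R. Lickorish, *A representation of orientable combinatorial 3-manifolds*, Ann. of Math.
  (2) 76 (1962), 531–540, p. 538. [LickorishAnnals1962]
* A. Juhász, *Differential and Low-Dimensional Topology*, LMS Student Texts 104 (2023), §3.5,
  p. 97 ("`S³` has a genus `g` Heegaard decomposition for every `g`"). [Juhasz2023]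
* A. A. Kosinski, *Differential Manifolds* (1993), VI (11.4)(c); VII §7, Exercise after (7.2).
  [Kosinski1993]
* J. Schultens, *Introduction to 3-Manifolds*, GSM 151 (2014), Def. 6.1.5, Ex. 6.1.8–6.1.9, §6.1
  Exercise 2. [Schultens2014]
* J. M. Lee, *Introduction to Smooth Manifolds*, 2nd ed. (2013), Ch. 1 (structures transported
  along bijections), Thm. 5.11 (the boundary as an embedded submanifold). [LeeSmoothManifolds2013]
-/

open scoped Manifold ContDiff Topology
open Function Set

noncomputable section

namespace Literature.Topology.FourManifolds

universe v u

/-! ### Lifting gluings along the boundary -/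

section Gluing

variable {EM HM EN HN E₀ H₀ E₀' H₀' EP HP : Type*}
  [NormedAddCommGroup EM] [NormedSpace ℝ EM] [TopologicalSpace HM] {IM : ModelWithCorners ℝ EM HM}
  [NormedAddCommGroup EN] [NormedSpace ℝ EN] [TopologicalSpace HN] {IN : ModelWithCorners ℝ EN HN}
  [NormedAddCommGroup E₀] [NormedSpace ℝ E₀] [TopologicalSpace H₀] {I₀ : ModelWithCorners ℝ E₀ H₀}
  [NormedAddCommGroup E₀'] [NormedSpace ℝ E₀'] [TopologicalSpace H₀']
  {I₀' : ModelWithCorners ℝ E₀' H₀'}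
  [NormedAddCommGroup EP] [NormedSpace ℝ EP] [TopologicalSpace HP] {IP : ModelWithCorners ℝ EP HP}
  {M : Type u} [TopologicalSpace M] [ChartedSpace HM M] [IsManifold IM ∞ M]
  {N : Type u} [TopologicalSpace N] [ChartedSpace HN N] [IsManifold IN ∞ N]
  {P : Type*} [TopologicalSpace P] [ChartedSpace HP P]

/-- **A gluing along the boundary lifts to `ULift` pieces**: if `P = M ∪_φ N`
(`Literature.Topology.FourManifolds.IsBoundaryGluing`) then `P = ULift M ∪_{up ∘ φ ∘ down} ULift N`
for the lifted boundary data (`BoundaryData.ulift`): precompose the piece embeddings with the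
diffeomorphisms `down : ULift M ≅ M`, `ULift N ≅ N` (`Manifold.IsSmoothEmbedding.comp_diffeomorph`);
ranges and the seam relation are unchanged. Hirsch, *Differential Topology* (1976), §8.2 (the
glued manifold depends only on the pieces up to compatible diffeomorphism). [folklore] -/
theorem IsBoundaryGluing.ulift {bM : BoundaryData IM M I₀} {bN : BoundaryData IN N I₀'}
    {φ : bM.carrier → bN.carrier} (h : IsBoundaryGluing bM bN φ IP P) :
    IsBoundaryGluing (bM.ulift : BoundaryData IM (ULift.{v} M) I₀)
      (bN.ulift : BoundaryData IN (ULift.{v} N) I₀') (ULift.up ∘ φ ∘ ULift.down) IP P := by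
  obtain ⟨jM, jN, hjM, hjN, hU, hR⟩ := h
  refine ⟨jM ∘ ULift.down, jN ∘ ULift.down,
    hjM.comp_diffeomorph (ManifoldULift.diffeomorph IM M ∞),
    hjN.comp_diffeomorph (ManifoldULift.diffeomorph IN N ∞), ?_, ?_⟩
  · rw [ULift.down_surjective.range_comp, ULift.down_surjective.range_comp]
    exact hU
  · rintro ⟨a⟩ ⟨c⟩
    simp only [comp_apply]
    rw [hR a c]
    constructor
    · rintro ⟨z, ha, hc⟩
      exact ⟨ULift.up z, ULift.ext _ _ (by simpa using ha), ULift.ext _ _ (by simpa using hc)⟩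
    · rintro ⟨z, ha, hc⟩
      exact ⟨z.down, by simpa using congrArg ULift.down ha, by simpa using congrArg ULift.down hc⟩

/-- The same for a gluing diffeomorphism `φ`, the lifted gluing map being the diffeomorphism
`down ≫ φ ≫ up : ULift ∂M ≅ ULift ∂N`. [folklore] -/
theorem IsBoundaryGluing.ulift' {bM : BoundaryData IM M I₀} {bN : BoundaryData IN N I₀'}
    {φ : bM.carrier ≃ₘ⟮I₀, I₀'⟯ bN.carrier} (h : IsBoundaryGluing bM bN φ IP P) :
    IsBoundaryGluing (bM.ulift : BoundaryData IM (ULift.{v} M) I₀)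
      (bN.ulift : BoundaryData IN (ULift.{v} N) I₀')
      ((ManifoldULift.diffeomorph I₀ bM.carrier ∞).trans
        (φ.trans (ManifoldULift.diffeomorph I₀' bN.carrier ∞).symm)) IP P :=
  h.ulift

end Gluing

/-- **Heegaard splittings lift**: if `Y = H ∪_φ H'` is a genus-`g` Heegaard splitting then so is
`Y = ULift H ∪_{down ≫ φ ≫ up} ULift H'` (`ManifoldULift.isHandlebody`, `IsBoundaryGluing.ulift'`).
Schultens (2014), Def. 6.1.7. [folklore] -/
theorem IsHeegaardSplitting.ulift {g : ℕ} {H : Type u} [TopologicalSpace H]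
    [ChartedSpace (EuclideanHalfSpace 3) H] [IsManifold (𝓡∂ 3) ∞ H] {H' : Type u}
    [TopologicalSpace H'] [ChartedSpace (EuclideanHalfSpace 3) H'] [IsManifold (𝓡∂ 3) ∞ H']
    {b : BoundaryData (𝓡∂ 3) H (𝓡 2)} {b' : BoundaryData (𝓡∂ 3) H' (𝓡 2)}
    {φ : b.carrier ≃ₘ⟮𝓡 2, 𝓡 2⟯ b'.carrier} {Y : Type*} [TopologicalSpace Y]
    [ChartedSpace (EuclideanSpace ℝ (Fin 3)) Y] (h : IsHeegaardSplitting g b b' φ Y) :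
    IsHeegaardSplitting g (b.ulift : BoundaryData (𝓡∂ 3) (ULift.{v} H) (𝓡 2))
      (b'.ulift : BoundaryData (𝓡∂ 3) (ULift.{v} H') (𝓡 2))
      ((ManifoldULift.diffeomorph (𝓡 2) b.carrier ∞).trans
        (φ.trans (ManifoldULift.diffeomorph (𝓡 2) b'.carrier ∞).symm)) Y :=
  ⟨ManifoldULift.isHandlebody h.isHandlebody_left, ManifoldULift.isHandlebody h.isHandlebody_right,
    h.isBoundaryGluing.ulift'⟩

/-! ### SPLIT in every universe; F2b₁ and F2b from UNIQ -/

/-- **Discharge of SPLIT** `Literature.Topology.FourManifolds.exists_isHeegaardSplitting_genus_sphere`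
**in every universe**: the round `3`-sphere has a genus-`g` Heegaard splitting into handlebodies
living in `Type u`, for every `g` — lift (`IsHeegaardSplitting.ulift`) the universe-`0` splitting
`𝕊 3 = {f ≤ c} ∪_{f⁻¹(c)} {c ≤ f}` of
`Literature.Topology.FourManifolds.exists_isHeegaardSplitting_sphere_genus_holds'`
(`SphereGenusSplitting.lean`). Juhász, *Differential and Low-Dimensional Topology* (2023), §3.5,
p. 97: "`S³` has a genus `g` Heegaard decomposition for every `g`"; Kosinski (1993), VII §7,
Exercise after (7.2); Schultens (2014), Ex. 6.1.8–6.1.9.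
[cite: Juhasz2023, §3.5 (p. 97)] -/
theorem exists_isHeegaardSplitting_genus_sphere_holds :
    exists_isHeegaardSplitting_genus_sphere.{u} := by
  intro g
  obtain ⟨H, _, _, _, _, _, H', _, _, _, _, _, b, b', φ, h⟩ :=
    exists_isHeegaardSplitting_sphere_genus_holds' g
  exact ⟨ULift.{u} H, inferInstance, inferInstance, inferInstance, inferInstance, inferInstance,
    ULift.{u} H', inferInstance, inferInstance, inferInstance, inferInstance, inferInstance,
    (b.ulift : BoundaryData (𝓡∂ 3) (ULift.{u} H) (𝓡 2)),
    (b'.ulift : BoundaryData (𝓡∂ 3) (ULift.{u} H') (𝓡 2)), _, h.ulift⟩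

/-- **F2b₁ from UNIQ alone** (Lickorish (1962), p. 538: "There is a piecewise linear
homeomorphism `i` such that `i : X₁ → X₂` and `S³ = T₁ ∪_i T₂`"): if any two genus-`g`
handlebodies are diffeomorphic (`IsHandlebody.nonempty_diffeomorph`, Kosinski (1993), VI (11.4)(c)),
then `S³` is the union of any two genus-`g` handlebodies along some diffeomorphism of their
boundaries — `IsHandlebody.exists_diffeomorph_isBoundaryGluing_sphere_of_nonempty_diffeomorph`
with SPLIT supplied by `exists_isHeegaardSplitting_genus_sphere_holds`.
[cite: LickorishAnnals1962, p. 538] -/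
theorem IsHandlebody.exists_diffeomorph_isBoundaryGluing_sphere_of_nonempty_diffeomorph'
    (hU : IsHandlebody.nonempty_diffeomorph.{u}) :
    IsHandlebody.exists_diffeomorph_isBoundaryGluing_sphere.{u} :=
  IsHandlebody.exists_diffeomorph_isBoundaryGluing_sphere_of_nonempty_diffeomorph hU
    exists_isHeegaardSplitting_genus_sphere_holds

/-- **F2b from UNIQ alone** (Lickorish (1962), pp. 538–539: "`S³ = T₁ ∪_i T₂`. We can choose
`i` so that `f⁻¹ i` is orientation preserving"): with SPLIT
(`exists_isHeegaardSplitting_genus_sphere_holds`) and SYMM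
(`exists_isHandlebody_isOrientationReversing_holds`, `HandlebodySymmetricModels.lean`) discharged,
Lickorish's F2b `IsHandlebody.exists_isBoundaryGluing_sphere` rests on the classification UNIQ
only — `IsHandlebody.exists_isBoundaryGluing_sphere_of_nonempty_diffeomorph`.
[cite: LickorishAnnals1962, pp. 538–539] -/
theorem IsHandlebody.exists_isBoundaryGluing_sphere_of_nonempty_diffeomorph''
    (hU : IsHandlebody.nonempty_diffeomorph.{u}) :
    IsHandlebody.exists_isBoundaryGluing_sphere.{u} :=
  IsHandlebody.exists_isBoundaryGluing_sphere_of_nonempty_diffeomorph hU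
    exists_isHeegaardSplitting_genus_sphere_holds exists_isHandlebody_isOrientationReversing_holds

/-- **Lickorish–Wallace from F1, UNIQ, F3, F4**: the assembly
`exists_isIntegralSurgeryLink_of_lickorish''` of `LickorishWallaceHandlebodies.lean` with SPLIT and
SYMM discharged. Lickorish (1962), proof of Thm 2, pp. 538–540.
[cite: LickorishAnnals1962, Thm. 2 and its proof (pp. 538–540)] -/
theorem exists_isIntegralSurgeryLink_of_lickorish''''
    (h₁ : exists_isHeegaardSplitting.{u}) (hU : IsHandlebody.nonempty_diffeomorph.{u})
    (h₄ : exists_isDehnTwist_isIsotopic_listProd.{u})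
    (h₅ : exists_isIntegralSurgeryLink_of_isBoundaryGluing_of_isIsotopic_listProd.{u}) :
    FourManifolds.exists_isIntegralSurgeryLink.{u} :=
  exists_isIntegralSurgeryLink_of_lickorish'' h₁ hU exists_isHeegaardSplitting_genus_sphere_holds
    exists_isHandlebody_isOrientationReversing_holds h₄ h₅

end Literature.Topology.FourManifolds
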